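import Summits.CriticalPhenomena.PercolationContinuityZ3.Theorems.Transplant.Bcc111SKPlan
import HarnessLib

/-!
# The bcc (111)-films at small thickness, VII: CERTIFICATE READERS and THE NODE CLAUSE of `ShapedLinkageX 3` for a covered case

builds on p205010 (kernel theorem, internal audit signed; external expert review pending) — NOT used in this file.  Lane `prim-bschramm`, seat
`prim-bschramm-p2` (gen 49; class C1b; memo `HOME/bschramm/P2-LATTICES.md` §160); helper file (`--supports stmt-CriticalPhenomena-4575 --as helper`).
The twin of «Slab111SKCase» for the exit-form checker «Bcc111SKDefs»:
* §1 `RowOK` / `CaseOK` (every needed bit of every certified pair has a covering plan), soundness of the readers `rdPlans`, `checkRow`, **`checkEs_sound`**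
  (a kernel-checked chunk gives row coverage), `caseOK_of_chunks`;
* §2 the admissibility masks `allowedM` / `forcedM` of the cleared mask;
* §3 **`linkageX_of_caseOK`** — `CaseOK C` + an admissible mask give the clause of `(Bcc111.hexShadow m).ShapedLinkageX 3` («HexShadowVRouteDataX») at every
  block centre of the case's class and all node parameters the case dominates.
[cite: DuminilCopinSidoraviciusTassion2016, §2.3 (proof of Fact 2: the three disjoint paths in B_R(z))]
-/

noncomputable section

namespace Summit.CriticalPhenomena.PercolationContinuityZ3.Theorems.Transplant

open Literature.Probability.Percolation Literature.Probability.LatticeModels SimpleGraph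
open scoped Classical

namespace Bcc111.SK

open Slab111.SK (dL dA dB bitOf sdiff lowStep lowIdx maskOfList endsOK maskBelow orFold rd rdMask colSlots testBit_bitOf testBit_sdiff
  testBit_maskBelow of_testBit_maskBelow testBit_maskBelow_of testBit_foldl_or testBit_orFold testBit_maskOfList testBit_maskOfList_eq_false
  testBit_of_sdiff_eq_zero testBit_of_sdiff_beq testBit_false_of_land_eq_zero endsOK_sound)

variable {C : CtxE} {z : Site 2}

/-! ## §1 Case coverage and the certificate readers -/

/-- **Row coverage**: every needed bit of every partner of `e₁` has a covering plan. [folklore] -/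
def RowOK (C : CtxE) (e1 : ℕ) : Prop :=
  ∀ e2 ∈ C.esList, e2 ≠ e1 → ∀ w, (C.needMask e1 e2).testBit w = true → ∃ c1 y b c2 av, (C.coverOf e1 e2 c1 y b c2 av).testBit w = true

/-- **Case coverage**: all rows. [folklore] -/
def CaseOK (C : CtxE) : Prop := ∀ e1 ∈ C.esList, RowOK C e1

/-- Soundness of the plan reader: an accumulated bit comes from the accumulator or from one of the plans read. [folklore] -/
theorem rdPlans_sound (C : CtxE) (e1 e2 w : ℕ) : ∀ (cnt n acc : ℕ), (C.rdPlans e1 e2 cnt n acc).1.testBit w = true →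
    acc.testBit w = true ∨ ∃ c1 y b c2 av, (C.coverOf e1 e2 c1 y b c2 av).testBit w = true
  | 0, _, _, h => Or.inl h
  | cnt + 1, n, acc, h => by
    simp only [CtxE.rdPlans] at h
    rcases rdPlans_sound C e1 e2 w cnt _ _ h with h | h
    · revert h
      cases (C.coverOf e1 e2 (rd n).1 (rd (rd n).2).1 (rd (rd (rd n).2).2).1 (rd (rd (rd (rd n).2).2).2).1
          (rdMask (rd (rd (rd (rd (rd n).2).2).2).2).1 (rd (rd (rd (rd (rd n).2).2).2).2).2 0).1 == 0) with
      | true => intro h; exact Or.inl h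
      | false =>
        intro h
        simp only [cond_false, Nat.testBit_lor, Bool.or_eq_true] at h
        rcases h with h | h
        · exact Or.inl h
        · exact Or.inr ⟨_, _, _, _, _, h⟩
    · exact Or.inr h

/-- **Soundness of the row checker.** [folklore] -/
theorem checkRow_sound (C : CtxE) (e1 : ℕ) : ∀ (es : List ℕ) (n : ℕ), C.checkRow e1 es n = true →
    ∀ e2 ∈ es, e2 ≠ e1 → ∀ w, (C.needMask e1 e2).testBit w = true → ∃ c1 y b c2 av, (C.coverOf e1 e2 c1 y b c2 av).testBit w = true
  | [], _, _ => fun _ h => nomatch h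
  | e2 :: rest, n, h => by
    intro x hx hxe w hw
    simp only [CtxE.checkRow] at h
    by_cases he : e2 = e1
    · have hb : (e2 == e1) = true := by simp [he]
      rw [hb, cond_true] at h
      rcases List.mem_cons.1 hx with rfl | hx
      · exact absurd he hxe
      · exact checkRow_sound C e1 rest n h x hx hxe w hw
    · have hb : (e2 == e1) = false := by simp [he]
      rw [hb, cond_false] at h
      by_cases hn : C.needMask e1 e2 = 0
      · have hb2 : (C.needMask e1 e2 == 0) = true := by simp [hn]
        rw [hb2, cond_true] at h
        rcases List.mem_cons.1 hx with rfl | hx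
        · rw [hn, Nat.zero_testBit] at hw; exact absurd hw Bool.false_ne_true
        · exact checkRow_sound C e1 rest n h x hx hxe w hw
      · have hb2 : (C.needMask e1 e2 == 0) = false := by simp [hn]
        rw [hb2, cond_false] at h
        try dsimp only at h
        generalize hr : C.rdPlans e1 e2 (rd n).1 (rd n).2 0 = r at h
        cases hs : (sdiff (C.needMask e1 e2) r.1 == 0) with
        | false => rw [hs] at h; exact absurd h Bool.false_ne_true
        | true =>
          rw [hs, cond_true] at h
          rcases List.mem_cons.1 hx with rfl | hx
          · have hcov := testBit_of_sdiff_beq hs hw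
            rw [← hr] at hcov
            rcases rdPlans_sound C e1 _ w _ _ _ hcov with h0 | hp
            · rw [Nat.zero_testBit] at h0; exact absurd h0 Bool.false_ne_true
            · exact hp
          · exact checkRow_sound C e1 rest _ h x hx hxe w hw

/-- **SOUNDNESS OF A KERNEL-CHECKED CHUNK**: `C.checkEs es certs = true` gives row coverage for every terminal of the chunk. [folklore] -/
theorem checkEs_sound (C : CtxE) : ∀ (es certs : List ℕ), C.checkEs es certs = true → ∀ e1 ∈ es, RowOK C e1
  | [], _, _ => fun _ h => nomatch h
  | e1 :: rest, certs, h => by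
    intro x hx
    cases certs with
    | nil => simp [CtxE.checkEs] at h
    | cons n certs' =>
      simp only [CtxE.checkEs] at h
      cases hrow : C.checkRow e1 C.esList n with
      | false => rw [hrow] at h; exact absurd h Bool.false_ne_true
      | true =>
        rw [hrow, cond_true] at h
        rcases List.mem_cons.1 hx with rfl | hx
        · exact fun e2 he2 hne w hw => checkRow_sound C x C.esList n hrow e2 he2 hne w hw
        · exact checkEs_sound C rest certs' h x hx

/-- **Case coverage from chunks covering the terminal list.** [folklore] -/
theorem caseOK_of_chunks (C : CtxE) (chunks : List (List ℕ)) (h : ∀ ch ∈ chunks, ∀ e1 ∈ ch, RowOK C e1)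
    (hcov : (C.esList.all fun e => chunks.any fun ch => ch.elem e) = true) : CaseOK C := by
  intro e1 he1
  rw [List.all_eq_true] at hcov
  have := hcov e1 he1
  rw [List.any_eq_true] at this
  obtain ⟨ch, hch, hel⟩ := this
  exact h ch hch e1 (List.elem_iff.1 hel)

/-! ## §2 Admissibility masks of the cleared mask -/

/-- Allowed bits: over `hexBall z 3 ∩ {a ≤ t₁} ∩ {a + b ≤ s₁}`. [folklore] -/
def CtxE.allowedB (C : CtxE) (t1 s1 i : ℕ) : Bool :=
  C.validB i && decide (2 ≤ dA i) && decide (dA i ≤ 8) && decide (2 ≤ dB i) && decide (dB i ≤ 8) && decide (7 ≤ dA i + dB i) &&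
    decide (dA i + dB i ≤ 13) && decide (dA i ≤ t1 + 5) && decide (dA i + dB i ≤ s1 + 10)

/-- Forced bits: over `hexBall z 1 ∩ {a ≤ t₁} ∩ {a + b ≤ s₁}`. [folklore] -/
def CtxE.forcedB (C : CtxE) (t1 s1 i : ℕ) : Bool :=
  C.validB i && decide (4 ≤ dA i) && decide (dA i ≤ 6) && decide (4 ≤ dB i) && decide (dB i ≤ 6) && decide (9 ≤ dA i + dB i) &&
    decide (dA i + dB i ≤ 11) && decide (dA i ≤ t1 + 5) && decide (dA i + dB i ≤ s1 + 10)

/-- The allowed mask. [folklore] -/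
def CtxE.allowedM (C : CtxE) (t1 s1 : ℕ) : ℕ := maskBelow (C.allowedB t1 s1) 1000
/-- The forced mask. [folklore] -/
def CtxE.forcedM (C : CtxE) (t1 s1 : ℕ) : ℕ := maskBelow (C.forcedB t1 s1) 1000

/-! ## §3 The node clause for a covered case -/

/-- **THE NODE CLAUSE OF `ShapedLinkageX 3` FOR ONE COVERED CASE.**  For a case context `C` with `CaseOK C` and an admissible cleared mask
(`C.wOK (allowedM t₁ s₁) (forcedM t₁ s₁)`, `t₁ ≤ t_D`, `s₁ ≤ s_D`, each either exact or `≥ 1`), every block centre `z` of class `C.c0` and all node parameters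
the case dominates (`C.tR = min t_R 3`, `C.sR = min s_R 3`, window bounds at least `t_D`, `s_R`, `s_D` or unconstrained): the cleared set `Wset C z` lies in
`\overline{blkR 3 z t_D s_D}`, contains every vertex over `hexBall z 1 ∩ blkR 3 z t_D s_D`, and every `TerminalsX`-certified triple has a swap pair of routings.
[cite: DuminilCopinSidoraviciusTassion2016, §2.3 (proof of Fact 2: the three disjoint paths in B_R(z))] -/
theorem linkageX_of_caseOK (hcase : CaseOK C) (hk : C.k ≤ 9) (hz : ClassHyp C z) {tR tD sR sD : ℕ}
    (htR : C.tR = min tR 3) (hsR : C.sR = min sR 3) (hwT : tD ≤ C.wT ∨ 4 ≤ C.wT) (hwS : sR ≤ C.wS ∨ 4 ≤ C.wS) (hwSD : sD ≤ C.wSD ∨ 4 ≤ C.wSD)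
    {t1 s1 : ℕ} (ht1 : t1 ≤ tD) (hs1 : s1 ≤ sD) (ht1' : t1 = tD ∨ 1 ≤ t1) (hs1' : s1 = sD ∨ 1 ≤ s1)
    (hW : C.wOK (C.allowedM t1 s1) (C.forcedM t1 s1) = true) :
    (∀ x ∈ Wset C z, (hexShadow C.k).sh x ∈ blkR 3 z tD sD) ∧
      (∀ x, (hexShadow C.k).sh x ∈ hexBall z 1 → (hexShadow C.k).sh x ∈ blkR 3 z tD sD → x ∈ Wset C z) ∧
        ∀ (E₁ E₂ w' : bfilm C.k), (hexShadow C.k).TerminalsX 3 z tR tD sR sD (Wset C z) E₁ E₂ w' →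
          ∃ r₁ r₂ : VRouteData (film C.k) (Wset C z ∩ (hexShadow C.k).lift (blkR 3 z tR sR)) (Wset C z) E₁ E₂ w', r₁.y = r₂.b ∧ r₁.b = r₂.y := by
  have hW' := hW
  simp only [CtxE.wOK, Bool.and_eq_true] at hW'
  obtain ⟨hWall, hWfor⟩ := hW'
  have hWdig : ∀ i, C.W.testBit i = true → C.validB i = true ∧
      (2 ≤ dA i ∧ dA i ≤ 8 ∧ 2 ≤ dB i ∧ dB i ≤ 8 ∧ 7 ≤ dA i + dB i ∧ dA i + dB i ≤ 13 ∧ dA i ≤ t1 + 5 ∧ dA i + dB i ≤ s1 + 10) := by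
    intro i hi
    have := of_testBit_maskBelow (testBit_of_sdiff_beq hWall hi)
    simp only [CtxE.allowedB, Bool.and_eq_true, decide_eq_true_eq] at this
    obtain ⟨⟨⟨⟨⟨⟨⟨⟨hv, h1⟩, h2⟩, h3⟩, h4⟩, h5⟩, h6⟩, h7⟩, h8⟩ := this.2
    exact ⟨hv, h1, h2, h3, h4, h5, h6, h7, h8⟩
  have hWv : ∀ i, C.W.testBit i = true → C.validB i = true := fun i hi => (hWdig i hi).1
  have hW3 : ∀ i, C.validB i = true → C.W.testBit i = true → triNorm (sh (ivtx C.k z i) - z) ≤ 3 := by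
    intro i hv hi
    have := mem_blkR_of_digits hz hv ht1 hs1 (hWdig i hi).2
    rw [mem_blkR, mem_hexBall] at this
    exact_mod_cast this.1
  refine ⟨fun x hx => ?_, fun x h1 hD => ?_, fun E₁ E₂ w' hT => ?_⟩
  · obtain ⟨i, hv, hWi, rfl⟩ := exists_idx_of_mem_Wset hx
    rw [hexShadow_sh]
    exact mem_blkR_of_digits hz hv ht1 hs1 (hWdig i hWi).2
  · rw [hexShadow_sh] at h1 hD
    obtain ⟨i, hv, rfl⟩ := exists_idx hz hk x (by rw [mem_hexBall] at h1; exact h1.trans (by norm_num))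
    obtain ⟨h1, h2, h3, h4, h5, h6, h7, h8⟩ := digits_of_mem_hexBall_one hz hv h1 hD
    have hf : C.forcedB t1 s1 i = true := by
      simp only [CtxE.forcedB, hv, Bool.true_and, Bool.and_eq_true, decide_eq_true_eq]
      refine ⟨⟨⟨⟨⟨⟨⟨h1, h2⟩, h3⟩, h4⟩, h5⟩, h6⟩, ?_⟩, ?_⟩
      · rcases ht1' with rfl | h; exact h7; omega
      · rcases hs1' with rfl | h; exact h8; omega
    exact (ivtx_mem_Wset_iff hz hv).2 (testBit_of_sdiff_beq hWfor (testBit_maskBelow_of ((validB_iff C i).1 hv).1 hf))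
  · obtain ⟨e1, e2, w, hv1, hv2, hvw, rfl, rfl, rfl, -, -, -, he1, he2, hne, hneed⟩ := terminalsX_sound hz hk htR hsR hwT hwS hwSD hW3 hT
    obtain ⟨c1, y, b, c2, av, hcov⟩ := hcase e1 he1 e2 he2 (Ne.symm hne) w hneed
    exact coverOf_sound hz htR hsR hWv hcov

end Bcc111.SK

end Summit.CriticalPhenomena.PercolationContinuityZ3.Theorems.Transplant

end
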